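import Summits.HodgeConjecture.HodgeConjecture.Theses.LinearSystemTorelli
import Literature.AlgebraicGeometry.HodgeTheory.HypersurfaceLefschetz
import Literature.AlgebraicGeometry.HodgeTheory.TopDegreeClasses

/-!
# Route LinearSystemTorelli — `DivisorInduction` (item stmt-HodgeConjecture-1082): the edge slices
# `p = 1` and `p ≥ n + 1` hold unconditionally; the item reduces to the band `2 ≤ p ≤ n`

Helper file (prover seat c4, `--supports stmt-HodgeConjecture-1082`). The route decl
`Summit.HodgeConjecture.HodgeConjecture.Theses.LinearSystemTorelli.DivisorInduction` quantifies over
all `n` and all `p ≥ 1`. Three of its slices need neither Deligne's Cor. 8.2.8 nor the lifting of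
Hodge classes along Gysin maps (the two leaves the general case is proved modulo, file
`LinearSystemTorelliDivisorInductionLeaves`):

* `p = 1`: TAUTOLOGICAL — `algebraicClasses X 1` is by definition `supportedClasses X (2 * 1) 1`
  (`Literature/AlgebraicGeometry/HodgeTheory/AlgebraicClasses`: `algebraicClasses X p :=
  supportedClasses X (2 * p) p`), so the support hypothesis IS the conclusion;
* `p = n + 1` (top degree of the `(n+1)`-fold `X`): every class of `H^{2(n+1)}(X(ℂ); ℂ)` is
  algebraic (`mem_algebraicClasses_of_degree_top`, the class of a point);
* `p > n + 1`: `H²ᵖ(X(ℂ); ℂ) = 0` above the real dimension (`algebraicClasses_eq_top_of_lt`).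

Hence `linearSystemTorelli_divisorInduction_of_band`: the route decl follows from its restriction
to `2 ≤ p ≤ n` — the band in which the printed proof genuinely uses Deligne, *Hodge III*,
Prop. 8.2.7 / Cor. 8.2.8 (the open leaf `Deligne1974_ker_pullback_eq_ker_pullback_resolution`).
Everything here is proved; no definitions, no named facts.
-/

noncomputable section

namespace Summit.HodgeConjecture.HodgeConjecture.Theorems

open Literature.AlgebraicGeometry.HodgeTheory Literature.AlgebraicGeometry.Motives

/-- **Slice `p = 1` of `DivisorInduction` is tautological**: on the tree's carriers
`algebraicClasses X 1 = N¹ H²(X(ℂ); ℂ) = supportedClasses X (2 * 1) 1` by definition, so a class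
supported on a divisor is algebraic in codimension `1` with no hypothesis at all (no smoothness,
rationality, Hodge type or inductive hypothesis is used). [cite: GrothendieckTopology1969, §1] -/
theorem linearSystemTorelli_divisorInduction_slice_one {X : SchemeOver ℂ}
    (c : complexBetti X (2 * 1)) (h : c ∈ supportedClasses X (2 * 1) 1) :
    c ∈ algebraicClasses X 1 :=
  h

/-- **Slices `p ≥ n + 1` of `DivisorInduction` hold unconditionally**: on a smooth projective
`X` of dimension `n + 1`, every class of degree `2p ≥ 2(n + 1)` is algebraic — for `p = n + 1`
it is a multiple of the class of a point (`mem_algebraicClasses_of_degree_top`), for `p > n + 1`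
the group `H²ᵖ(X(ℂ); ℂ)` vanishes (`algebraicClasses_eq_top_of_lt`).
[cite: VoisinHodgeI2002, §11.1.2] [cite: HatcherAT2002, §3.3 Thm. 3.26 (c)] -/
theorem linearSystemTorelli_divisorInduction_slice_top {n p : ℕ} (hp : n + 1 ≤ p)
    {X : SchemeOver ℂ} (hX : IsSmoothProjective (n + 1) X) (c : complexBetti X (2 * p)) :
    c ∈ algebraicClasses X p := by
  rcases hp.eq_or_lt with rfl | hlt
  · exact mem_algebraicClasses_of_degree_top hX (Nat.succ_le_succ (Nat.zero_le n)) c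
  · rw [algebraicClasses_eq_top_of_lt hX hlt]
    exact Submodule.mem_top

/-- **`DivisorInduction` reduces to the band `2 ≤ p ≤ n`.** If, for all `n` and all `p` with
`2 ≤ p ≤ n`, the Hodge conjecture in codimension `p − 1` for smooth projective `n`-folds implies
that on every smooth projective `(n+1)`-fold every rational `(p,p)`-class supported on a divisor
is algebraic, then the route decl `DivisorInduction` holds outright: the remaining slices are
`p = 1` (tautological, `linearSystemTorelli_divisorInduction_slice_one`) and `p ≥ n + 1`
(`linearSystemTorelli_divisorInduction_slice_top`). The band is exactly where the printed proof
invokes Deligne, *Hodge III*, Cor. 8.2.8. [cite: DeligneHodgeIII1974, Cor. 8.2.8]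
[cite: Thomas2005Nodes, §2] -/
theorem linearSystemTorelli_divisorInduction_of_band
    (h : ∀ (n p : ℕ), 2 ≤ p → p ≤ n →
      (∀ ⦃Y : SchemeOver ℂ⦄, IsSmoothProjective n Y →
        ∀ c : complexBetti Y (2 * (p - 1)), IsRationalClass c →
          IsOfHodgeType n Y (2 * (p - 1)) (p - 1) (p - 1) c → c ∈ algebraicClasses Y (p - 1)) →
      ∀ ⦃X : SchemeOver ℂ⦄, IsSmoothProjective (n + 1) X →
        ∀ c : complexBetti X (2 * p), IsRationalClass c → IsOfHodgeType (n + 1) X (2 * p) p p c →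
          c ∈ supportedClasses X (2 * p) 1 → c ∈ algebraicClasses X p) :
    Summit.HodgeConjecture.HodgeConjecture.Theses.LinearSystemTorelli.DivisorInduction := by
  unfold Summit.HodgeConjecture.HodgeConjecture.Theses.LinearSystemTorelli.DivisorInduction
  intro n p hp hHC X hX c hc hc' hsupp
  rcases Nat.lt_or_ge n p with hnp | hpn
  · exact linearSystemTorelli_divisorInduction_slice_top hnp hX c
  · rcases hp.eq_or_lt with rfl | h2
    · exact linearSystemTorelli_divisorInduction_slice_one c hsupp
    · exact h n p h2 hpn hHC hX c hc hc' hsupp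

end Summit.HodgeConjecture.HodgeConjecture.Theorems

end
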